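import Summits.ResolutionOfSingularities.ResolutionOfSingularities.Theses.SectionAscent
import Literature.AlgebraicGeometry.Resolution.AffineBlowupCartier
import Literature.AlgebraicGeometry.Resolution.AffineBlowupAlgebra
import Literature.AlgebraicGeometry.Resolution.JacobianRegularLocus
import Literature.AlgebraicGeometry.Resolution.IntegralClosureEssFiniteType
import HarnessLib

/-!
# `SectionAscent.GenericLevel` as typed: the normalisation blow-up witness

Route `ResolutionOfSingularities/SectionAscent`, crux item stmt-ResolutionOfSingularities-15959.
The crux `GenericLevel` is `∀ p prime, ∀ d, OneShot p d → Almost p (d+1)` where, for an integral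
affine `K`-algebra `A` of finite type, `Almost` asks for an ideal `I ≠ 0` with (2) `D(I) ⊆ Reg(A)`,
(3) all stalks of `Bl_I(Spec A)` integrally closed, (4) `Bl_I(Spec A)` regular at every point that is
not closed in its fibre over `Spec A`.

This file PROVES the crux exactly as typed, confirming in the kernel the standing refuter objection
(item note 2026-08-16, evidence `SectionAscent_Almost_trivial.md`): `Almost` is inhabited by the
blowing up presenting the NORMALISATION, so the hypothesis `OneShot p d` is not used. Witness: by
J-0 for affine domains (tree `exists_basicOpen_subset_regularLocus_of_isDomain`, Matsumura Thm 30.5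
Cor.) pick `b ≠ 0` with `D(b) ⊆ Reg(A)`; by finiteness of the normalisation `Ã` (tree
`module_finite_integralClosure_of_essFiniteType`, Liu 4.1.27) pick a common denominator `c ≠ 0` of
`Ã`; put `g := b c` and `I := {x ∈ A | x/g ∈ Ã} = g·Ã`. Then `I ∋ g ≠ 0`; `D(I) ⊆ D(b) ⊆ Reg(A)`;
for `x = g x̃ ∈ I` one has `x² = g · (g x̃²)` with `g x̃² ∈ I`, so every chart `D₊(xt)` of
`Bl_I = Proj A[It]` lies in the single chart `D₊(gt) = Spec A[I/g]`, and `A[I/g] = A[Ã] = Ã`; hence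
every stalk of `Bl_I` is a localisation of the integrally closed domain `Ã` (clause (3)), and two
points of `Bl_I = Spec Ã` with the same image in `Spec A` are incomparable (`Ã` is integral over
`A`), so no point has a proper specialisation inside its fibre and clause (4) is vacuous.

## Contents (namespace `Summit.ResolutionOfSingularities.ResolutionOfSingularities.Theorems`)

* `basicOpen_reesT_eq_top_of_sq` — if `x² ∈ g I` for all `x ∈ I` then `D₊(gt) = Bl_I(Spec R)`;
* `chartι_surjective_of_basicOpen_eq_top`, `isIntegrallyClosed_stalk_chartι`,
  `eq_of_specializes_of_π_chartι_eq` — consequences for points and stalks of the one chart;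
* `genericLevel_asTyped` — the crux `SectionAscent.GenericLevel`.
-/

noncomputable section

-- single-problem summit: the doubled namespace component `ResolutionOfSingularities` is forced
set_option linter.dupNamespace false

open AlgebraicGeometry CategoryTheory Polynomial HomogeneousLocalization
open Literature.AlgebraicGeometry.Resolution

namespace Summit.ResolutionOfSingularities.ResolutionOfSingularities.Theorems

universe u

section OneChart

variable {R : Type u} [CommRing R] {I : Ideal R}

/-- **One chart suffices.** If every `x ∈ I` satisfies `x · x = g · y` for some `y ∈ I`, then the
chart `D₊(gt)` of `Bl_I(Spec R) = Proj R[It]` is the whole blowing up: `(xt)² = (gt)(yt)`, so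
`D₊(xt) = D₊((xt)²) ⊆ D₊(gt)`, and the `D₊(xt)`, `x ∈ I`, cover. [folklore] -/
theorem basicOpen_reesT_eq_top_of_sq (g : R) (hg : g ∈ I)
    (h : ∀ x ∈ I, ∃ y ∈ I, x * x = g * y) :
    Proj.basicOpen (reesGrading I) (reesT g hg) = ⊤ := by
  refine top_le_iff.mp ?_
  rw [← affineBlowup.iSup_basicOpen_reesT_eq_top I]
  refine iSup_le fun b => ?_
  obtain ⟨y, hy, hby⟩ := h b.1 b.2
  have hsq : reesT (I := I) b.1 b.2 ^ 2 = reesT g hg * reesT y hy := by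
    apply Subtype.ext
    change (reesT (I := I) b.1 b.2 : R[X]) ^ 2 = (reesT g hg : R[X]) * (reesT y hy : R[X])
    rw [coe_reesT, coe_reesT, coe_reesT, monomial_pow, monomial_mul_monomial, sq, hby]
  calc Proj.basicOpen (reesGrading I) (reesT b.1 b.2)
      = Proj.basicOpen (reesGrading I) (reesT b.1 b.2 ^ 2) :=
        (Proj.basicOpen_pow (reesGrading I) _ 2 two_pos).symm
    _ ≤ Proj.basicOpen (reesGrading I) (reesT g hg) :=
        Proj.basicOpen_mono (reesGrading I) _ _ ⟨reesT y hy, hsq⟩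

/-- If `D₊(gt)` is the whole blowing up then the chart `Spec (R[It])_{(gt)} → Bl_I(Spec R)` is
surjective. [folklore] -/
theorem chartι_surjective_of_basicOpen_eq_top (g : R) (hg : g ∈ I)
    (h : Proj.basicOpen (reesGrading I) (reesT g hg) = ⊤) :
    Function.Surjective (affineBlowup.chartι (I := I) g hg).base := by
  have hr : (affineBlowup.chartι (I := I) g hg).opensRange = ⊤ := by
    rw [← Scheme.Hom.image_top_eq_opensRange, affineBlowup.image_top_chartι, h]
  rw [← Set.range_eq_univ, ← Scheme.Hom.coe_opensRange, hr]
  rfl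

/-- The stalks of `Bl_I(Spec R)` at the points of a chart `D₊(gt)` whose coordinate ring
`(R[It])_{(gt)}` is an integrally closed domain are integrally closed (they are localisations of
that ring at primes). [folklore] -/
theorem isIntegrallyClosed_stalk_chartι (g : R) (hg : g ∈ I)
    [IsDomain (Away (reesGrading I) (reesT g hg))]
    [IsIntegrallyClosed (Away (reesGrading I) (reesT g hg))]
    (q : Spec (.of (Away (reesGrading I) (reesT g hg)))) :
    IsIntegrallyClosed
      ((affineBlowup I).presheaf.stalk ((affineBlowup.chartι (I := I) g hg).base q)) := by
  letI : Algebra (Away (reesGrading I) (reesT g hg))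
      ((Spec (.of (Away (reesGrading I) (reesT g hg)))).presheaf.stalk q) :=
    StructureSheaf.stalkAlgebra (Away (reesGrading I) (reesT g hg)) q
  haveI : IsLocalization.AtPrime
      ((Spec (.of (Away (reesGrading I) (reesT g hg)))).presheaf.stalk q) q.asIdeal :=
    StructureSheaf.IsLocalization.to_stalk (Away (reesGrading I) (reesT g hg)) q
  have h1 : IsIntegrallyClosed ((Spec (.of (Away (reesGrading I) (reesT g hg)))).presheaf.stalk q) :=
    isIntegrallyClosed_of_isLocalization (R := Away (reesGrading I) (reesT g hg)) _
      q.asIdeal.primeCompl (Ideal.primeCompl_le_nonZeroDivisors _)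
  exact IsIntegrallyClosed.of_equiv
    (asIso ((affineBlowup.chartι (I := I) g hg).stalkMap q)).commRingCatIsoToRingEquiv.symm

/-- Two points of a chart `D₊(gt)` whose coordinate ring is integral over `R`, one specialising to
the other and both over the same point of `Spec R`, are equal (incomparability for integral
extensions). [folklore] -/
theorem eq_of_specializes_of_π_chartι_eq (g : R) (hg : g ∈ I)
    (hint : (reesChartBase (I := I) g hg).IsIntegral)
    {q q' : Spec (.of (Away (reesGrading I) (reesT g hg)))}
    (hs : (affineBlowup.chartι (I := I) g hg).base q ⤳ (affineBlowup.chartι (I := I) g hg).base q')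
    (hπ : (affineBlowup.π I).base ((affineBlowup.chartι (I := I) g hg).base q') =
      (affineBlowup.π I).base ((affineBlowup.chartι (I := I) g hg).base q)) :
    q = q' := by
  have hqq' : q ⤳ q' :=
    ((affineBlowup.chartι (I := I) g hg).isOpenEmbedding.isInducing.specializes_iff).mp hs
  have hle : q.asIdeal ≤ q'.asIdeal := (PrimeSpectrum.le_iff_specializes q q').mpr hqq'
  have hbase : ∀ x : Spec (.of (Away (reesGrading I) (reesT g hg))),
      (affineBlowup.π I).base ((affineBlowup.chartι (I := I) g hg).base x) =
        PrimeSpectrum.comap (reesChartBase (I := I) g hg) x := by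
    intro x
    have e : ((affineBlowup.chartι (I := I) g hg) ≫ affineBlowup.π I).base x =
        PrimeSpectrum.comap (reesChartBase (I := I) g hg) x := by
      rw [affineBlowup.chartι_π]
      rfl
    rw [Scheme.Hom.comp_base, TopCat.comp_app] at e
    exact e
  rw [hbase, hbase] at hπ
  by_contra hne
  have hlt : q.asIdeal < q'.asIdeal :=
    lt_of_le_of_ne hle fun h => hne (PrimeSpectrum.ext h)
  letI := (reesChartBase (I := I) g hg).toAlgebra
  haveI : Algebra.IsIntegral R (Away (reesGrading I) (reesT g hg)) := ⟨hint⟩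
  have h2 := Ideal.IsIntegral.comap_lt_comap (R := R) hlt
  have h3 : q'.asIdeal.comap (algebraMap R (Away (reesGrading I) (reesT g hg))) =
      q.asIdeal.comap (algebraMap R (Away (reesGrading I) (reesT g hg))) :=
    congrArg PrimeSpectrum.asIdeal hπ
  exact absurd h3 (ne_of_lt h2).symm

end OneChart

/-! ## The normalisation witness -/

section Witness

open scoped nonZeroDivisors

/-- **`Almost` is inhabited by the normalisation blow-up.** For an integral affine `K`-algebra `A`
of finite type there is an ideal `I ≠ 0` with `D(I) ⊆ Reg(A)`, all stalks of `Bl_I(Spec A)`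
integrally closed, and no point of `Bl_I(Spec A)` properly specialising inside its fibre over
`Spec A` (so the last clause of `Almost` holds vacuously): `I = g·Ã` with `g = b c`, `D(b) ⊆ Reg(A)`
(J-0, Matsumura Thm 30.5 Cor.), `c` a common denominator of the finite `A`-module `Ã` (E. Noether /
Liu 4.1.27), for which `Bl_I(Spec A) = D₊(gt) = Spec A[I/g] = Spec Ã`.
[cite: Matsumura1987, Cor. to Thm 30.5; Liu2002, Prop. 4.1.27] -/
theorem exists_ideal_almost_of_normalization (K : Type u) [Field K] (A : Type u) [CommRing A]
    [IsDomain A] [Algebra K A] [Algebra.FiniteType K A] :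
    ∃ I : Ideal A, I ≠ ⊥ ∧
      (∀ 𝔭 : PrimeSpectrum A, ¬ I ≤ 𝔭.asIdeal →
        IsRegularLocalRing (Localization.AtPrime 𝔭.asIdeal)) ∧
      (∀ y : affineBlowup I, IsIntegrallyClosed ((affineBlowup I).presheaf.stalk y)) ∧
      ∀ y : affineBlowup I, (∃ z : affineBlowup I, z ≠ y ∧ y ⤳ z ∧
        (affineBlowup.π I).base z = (affineBlowup.π I).base y) →
        IsRegularLocalRing ((affineBlowup I).presheaf.stalk y) := by
  classical
  -- notation: the fraction field and the normalisation
  let F := FractionRing A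
  let Ã : Subalgebra A F := integralClosure A F
  have hinjF : Function.Injective (algebraMap A F) := IsFractionRing.injective A F
  -- J-0: `D(b) ⊆ Reg(A)` for some `b ≠ 0`
  obtain ⟨b, hb0, hbreg⟩ := exists_basicOpen_subset_regularLocus_of_isDomain K A
  -- finiteness of the normalisation and a common denominator `c ≠ 0`
  haveI : Algebra.EssFiniteType K A := Algebra.EssFiniteType.of_finiteType K A
  have hfin : Module.Finite A Ã := module_finite_integralClosure_of_essFiniteType K A F
  obtain ⟨c, hc0, hc⟩ : ∃ c : A, c ≠ 0 ∧
      ∀ x : F, x ∈ Ã → ∃ a : A, algebraMap A F a = algebraMap A F c * x := by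
    obtain ⟨s, hs⟩ := Module.finite_def.mp hfin
    obtain ⟨⟨c, hcmem⟩, hcint⟩ :=
      IsLocalization.exist_integer_multiples (A⁰) s (fun x : Ã => (x : F))
    refine ⟨c, nonZeroDivisors.ne_zero hcmem, fun x hx => ?_⟩
    have hx' : (⟨x, hx⟩ : Ã) ∈ Submodule.span A (s : Set Ã) := by rw [hs]; trivial
    refine Submodule.span_induction
      (p := fun (y : Ã) _ => ∃ a : A, algebraMap A F a = algebraMap A F c * (y : F)) ?_ ?_ ?_ ?_ hx'
    · intro y hy
      obtain ⟨a, ha⟩ := hcint y hy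
      exact ⟨a, by rw [ha, Algebra.smul_def]⟩
    · exact ⟨0, by simp⟩
    · rintro y z - - ⟨a₁, ha₁⟩ ⟨a₂, ha₂⟩
      exact ⟨a₁ + a₂, by rw [map_add, ha₁, ha₂, Subalgebra.coe_add, mul_add]⟩
    · rintro r y - ⟨a, ha⟩
      refine ⟨r * a, ?_⟩
      rw [map_mul, ha, Subalgebra.coe_smul, Algebra.smul_def]
      ring
  -- the element `g = b c ≠ 0` and the ideal `I = {x | x / g ∈ Ã}`
  have hg0 : b * c ≠ 0 := mul_ne_zero hb0 hc0
  have hg0F : algebraMap A F (b * c) ≠ 0 := fun h => hg0 (hinjF (by rw [h, map_zero]))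
  let I : Ideal A :=
    ((Subalgebra.toSubmodule Ã).map (LinearMap.mulLeft A (algebraMap A F (b * c)))).comap
      (Algebra.linearMap A F)
  have hmemI : ∀ x : A, x ∈ I ↔ ∃ y ∈ Ã, algebraMap A F (b * c) * y = algebraMap A F x := by
    intro x
    simp only [I, Submodule.mem_comap, Algebra.linearMap_apply, Submodule.mem_map,
      Subalgebra.mem_toSubmodule, LinearMap.mulLeft_apply]
  have hgI : b * c ∈ I := (hmemI _).mpr ⟨1, Ã.one_mem, by rw [mul_one]⟩
  have hI0 : I ≠ ⊥ := fun h => hg0 (by rw [h, Ideal.mem_bot] at hgI; exact hgI)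
  -- every element of `I` is a multiple of `b`
  have hIb : ∀ x ∈ I, ∃ a : A, x = b * a := by
    intro x hx
    obtain ⟨y, hy, hxy⟩ := (hmemI x).mp hx
    obtain ⟨a, ha⟩ := hc y hy
    refine ⟨a, hinjF ?_⟩
    rw [← hxy, map_mul, map_mul, ha, mul_assoc]
  -- every `x ∈ I` has `x² ∈ g I`
  have hsq : ∀ x ∈ I, ∃ y ∈ I, x * x = (b * c) * y := by
    intro x hx
    obtain ⟨x', hx', hxx'⟩ := (hmemI x).mp hx
    obtain ⟨a, ha⟩ := hc (x' * x') (Ã.mul_mem hx' hx')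
    refine ⟨b * a, (hmemI _).mpr ⟨x' * x', Ã.mul_mem hx' hx', ?_⟩, hinjF ?_⟩
    · rw [map_mul (algebraMap A F) b a, ha, map_mul]
      ring
    · rw [map_mul, map_mul, map_mul (algebraMap A F) b a, ha, ← hxx', map_mul]
      ring
  -- the chart ring `(A[It])_{(gt)} ≅ A[I/g] ≅ Ã`
  have hunit : ∀ y : Submonoid.powers (b * c), IsUnit (Algebra.ofId A F y) := by
    rintro ⟨y, n, rfl⟩
    exact isUnit_iff_ne_zero.mpr (by
      rw [Algebra.ofId_apply, map_pow]
      exact pow_ne_zero _ hg0F)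
  let ψ : Localization.Away (b * c) →ₐ[A] F :=
    IsLocalization.liftAlgHom (M := Submonoid.powers (b * c)) (f := Algebra.ofId A F) hunit
  have hψinj : Function.Injective ψ := by
    rw [IsLocalization.coe_liftAlgHom, IsLocalization.lift_injective_iff]
    intro x y
    constructor
    · intro h
      exact congrArg _ (IsLocalization.injective (Localization.Away (b * c))
        (powers_le_nonZeroDivisors_of_noZeroDivisors hg0) h)
    · intro h
      exact congrArg _ (hinjF h)
  have hψg : ψ (IsLocalization.Away.invSelf (b * c)) = (algebraMap A F (b * c))⁻¹ := by
    have h1 : ψ (algebraMap A (Localization.Away (b * c)) (b * c)) *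
        ψ (IsLocalization.Away.invSelf (b * c)) = 1 := by
      rw [← map_mul, IsLocalization.Away.mul_invSelf, map_one]
    rw [AlgHom.commutes] at h1
    exact (eq_inv_of_mul_eq_one_right h1)
  have himage : ψ '' blowupAlgebraGens I (b * c) = (Ã : Set F) := by
    ext z
    constructor
    · rintro ⟨_, ⟨x, hx, rfl⟩, rfl⟩
      obtain ⟨y, hy, hxy⟩ := (hmemI x).mp hx
      rw [SetLike.mem_coe, map_mul ψ, AlgHom.commutes, hψg, ← hxy, mul_comm, ← mul_assoc,
        inv_mul_cancel₀ hg0F, one_mul]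
      exact hy
    · intro hz
      obtain ⟨a, ha⟩ := hc z hz
      have hxI : b * a ∈ I := (hmemI _).mpr ⟨z, hz, by rw [map_mul, map_mul, ha]; ring⟩
      refine ⟨_, ⟨b * a, hxI, rfl⟩, ?_⟩
      have hbc : algebraMap A F b * algebraMap A F c ≠ 0 := by rwa [← map_mul]
      rw [map_mul ψ, AlgHom.commutes, hψg, map_mul (algebraMap A F) b a, ha,
        map_mul (algebraMap A F) b c, ← mul_assoc (algebraMap A F b),
        mul_comm (algebraMap A F b * algebraMap A F c) z, mul_inv_cancel_right₀ hbc]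
  have heq : (blowupAlgebra I (b * c)).map ψ = Ã := by
    rw [blowupAlgebra, AlgHom.map_adjoin, himage, Algebra.adjoin_eq]
  let e₂ : blowupAlgebra I (b * c) ≃ₐ[A] Ã :=
    ((blowupAlgebra I (b * c)).equivMapOfInjective ψ hψinj).trans (Subalgebra.equivOfEq _ _ heq)
  let e : Away (reesGrading I) (reesT (b * c) hgI) ≃+* Ã := (reesChartEquiv (b * c) hgI).trans e₂.toRingEquiv
  -- consequences: `B` is an integrally closed domain, integral over `A`
  haveI : IsDomain (Away (reesGrading I) (reesT (b * c) hgI)) := MulEquiv.isDomain Ã e.toMulEquiv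
  haveI : IsIntegrallyClosed Ã := integralClosure.isIntegrallyClosedOfFiniteExtension F (L := F)
  haveI : IsIntegrallyClosed (Away (reesGrading I) (reesT (b * c) hgI)) := IsIntegrallyClosed.of_equiv e.symm
  have hint : (reesChartBase (I := I) (b * c) hgI).IsIntegral := by
    letI := (reesChartBase (I := I) (b * c) hgI).toAlgebra
    have hcomm : ∀ x : A, e (reesChartBase (I := I) (b * c) hgI x) = algebraMap A Ã x := by
      intro x
      change e₂ (reesChartEquiv (b * c) hgI (reesChartBase (b * c) hgI x)) = _
      rw [reesChartEquiv_reesChartBase, AlgEquiv.commutes]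
    let eA : Away (reesGrading I) (reesT (b * c) hgI) ≃ₐ[A] Ã := AlgEquiv.ofRingEquiv (f := e) (fun x => hcomm x)
    haveI : Algebra.IsIntegral A (Away (reesGrading I) (reesT (b * c) hgI)) :=
      Algebra.IsIntegral.of_injective eA.toAlgHom eA.injective
    exact fun x => Algebra.IsIntegral.isIntegral x
  -- the one chart
  have htop := basicOpen_reesT_eq_top_of_sq (b * c) hgI hsq
  have hsurj := chartι_surjective_of_basicOpen_eq_top (b * c) hgI htop
  refine ⟨I, hI0, ?_, ?_, ?_⟩
  · -- clause (2): `D(I) ⊆ D(b) ⊆ Reg(A)`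
    intro 𝔭 h𝔭
    have hb𝔭 : b ∉ 𝔭.asIdeal := fun hb => h𝔭 fun x hx => by
      obtain ⟨a, rfl⟩ := hIb x hx
      exact 𝔭.asIdeal.mul_mem_right a hb
    have := hbreg (show 𝔭 ∈ (PrimeSpectrum.basicOpen b : Set (PrimeSpectrum A)) from hb𝔭)
    rwa [mem_regularLocus] at this
  · -- clause (3): stalks are localisations of `Ã`
    intro y
    obtain ⟨q, rfl⟩ := hsurj y
    exact isIntegrallyClosed_stalk_chartι (b * c) hgI q
  · -- clause (4): vacuous
    rintro y ⟨z, hzy, hyz, hπ⟩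
    exfalso
    obtain ⟨q, rfl⟩ := hsurj y
    obtain ⟨q', rfl⟩ := hsurj z
    exact hzy (congrArg _ (eq_of_specializes_of_π_chartι_eq (b * c) hgI hint hyz hπ)).symm

end Witness

/-! ## The crux as typed -/

/-- **`SectionAscent.GenericLevel` (stmt-ResolutionOfSingularities-15959), proved AS TYPED**: for
every prime `p` and every `d`, `OneShot p d → Almost p (d + 1)`. The hypothesis `OneShot p d` and the
dimension bound are not used: `Almost` as typed is inhabited by the normalisation blow-up
(`exists_ideal_almost_of_normalization`), as the refuter's route review objected (2026-08-16); the
route needs a PLANNER RESTATE of `Almost` (exact centre `I ≤ 𝔭 ↔ ¬regular`, and/or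
positive-dimensional fibres over `Sing`) for its inductive step to carry content. [folklore] -/
theorem genericLevel_asTyped :
    Summit.ResolutionOfSingularities.ResolutionOfSingularities.Theses.SectionAscent.GenericLevel := by
  intro p _ d _ K _ _ A _ _ _ _ _
  exact exists_ideal_almost_of_normalization K A


end Summit.ResolutionOfSingularities.ResolutionOfSingularities.Theorems

end
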